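import Summits.CriticalPhenomena.Ising3DConformalLimit.Theses.EnergyNotSigmaSquared
import Summits.CriticalPhenomena.Ising3DConformalLimit.Theorems.EnergyNotSigmaSquaredEnergyGapSoftMerging
import Literature.Probability.LatticeModels.CriticalAxisRatioRegularity
import Literature.Probability.LatticeModels.HighDimPointwiseTriviality
import Literature.Probability.LatticeModels.CorrelationInequalitiesProofs

/-!
# Disproof of `EnergyGapPowerLaw` (crux `stmt-CriticalPhenomena-4469`) — standing adversary file

Route `route-CriticalPhenomena-EnergyNotSigmaSquared`, sub-problem `Ising3DConformalLimit`.
The crux (GAP, "ε is not σ²"): `∃ κ > 0, ∃ C, ∀ x ≠ 0 in ℤ³,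
T(x) := ⟨σ₀σ_{e₂}σ_xσ_{x+e₂}⟩_{β_c} − ⟨σ₀σ_{e₂}⟩_{β_c}⟨σ_xσ_{x+e₂}⟩_{β_c} ≤ C‖x‖^{-κ}⟨σ₀σ_x⟩²_{β_c}`
(plus state at `β_c(3)`, sup norm, `e₂ = Pi.single 1 1`, `G := criticalTwoPoint 3`).  Everything
below is `lean check`ed, sorry-free, axioms `{propext, Classical.choice, Quot.sound}`.
Generation 1 wrote §0–§6 (cycle 1); generation 2 (this seat) adds §7–§9 (cycle 2) and re-homes the
landable lemmas under `Theorems/EnergyGapPowerLaw/Negative/` (see HANDOFF in the seat's NOTES.md).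

## Verdict after cycle 2: RESISTS (open problem, predicted TRUE with exponent margin ≈ 0.75)

* Semantics audited (§0, gen 1): `criticalCorr 3 n` is the genuine plus-state box limit of spin
  monomials at `criticalBeta 3 = inf{β ≥ 0 | m*(β) > 0}` (no interface, no placeholder; the two-point
  bounds `c‖x‖⁻² ≤ G ≤ C‖x‖⁻¹`, `criticalTwoPoint_bounds_holds`, are THEOREMS of the tree — infrared
  bound, MMS, ADS15 — so `β_c(3) > 0` and the state is the physical one); the norm on
  `Site 3 = Fin 3 → ℤ` is Mathlib's Pi sup norm, `‖x‖ ≥ 1` for `x ≠ 0` (`one_le_norm`), so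
  `‖x‖^{-κ}` (`Real.rpow`) is harmless; coincident sites `x = ±e₂` are handled correctly by
  `spinMonomial` (`σ² = 1`) and absorbed into `C` (§5).  No junk value, no vacuity.
* Physics: the bond operator couples to `ε` (lowest `ℤ₂`-even non-trivial primary; the spin-2
  stress-tensor admixture of a fixed-direction bond decays faster, `|x|^{-6}`), so
  `T(x) ~ A|x|^{-2Δ_ε}` against `G(x)² ~ B|x|^{-4Δ_σ}`; `κ_max = 2(Δ_ε − 2Δ_σ) = 0.7527` from
  `Δ_σ = 0.5181489(10)`, `Δ_ε = 1.412625(10)` (conformal bootstrap; Hasenbusch arXiv:1711.10946 §7.1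
  measures the `εε` function at criticality on lattices up to `L = 1600` consistent with
  `x^{-2Δ_ε}`), equivalently `γ = ν(2−η) ≈ 1.237 > 1`.  `d = 2`: `κ = 3/2` exactly.  No rigorous result
  pins any `d = 3` exponent off its mean-field value, in either direction.  The crux is an UPPER
  bound with SOME `κ > 0`, so it is robust to every sub-leading correction; it fails only in a
  mean-field energy sector (`Δ_ε = 2Δ_σ`: `d ≥ 5`, `d = 4` with logarithms, RP long range `α < 3/2`).
* Negatives index (`ledger negatives --problem CriticalPhenomena`) and the `*Refutations.lean` files
  of the sub-problem concern degenerate scaling limits / SAW / percolation costumes; none touches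
  lattice energy correlations.

## Findings (all theorems of this file)

* §1 `criticalU4_nonpos` — Lebowitz `U₄ ≤ 0` for `criticalCorr d`, `d ≥ 3`.
* §2 dictionary: `criticalCorr_two_eq_plusCorr`, `criticalCorr_four_eq_plusCorr`,
  `criticalTwoPoint_add_mul_le` / `criticalTwoPoint_mul_le_add` (GKS II `G(x+v)G(v) ≤ G(x)`,
  `G(x)G(v) ≤ G(x+v)`), `criticalTwoPoint_pos`, `criticalTwoPoint_e₂_pos`, `criticalTwoPoint_e₂_lt_one`.
* §3 **BOUNDARY CASE `κ = 0` HOLDS** — `energyTrunc_le_pairings` (`T(x) ≤ G(x)² + G(x+e₂)G(x−e₂)`),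
  `energyTrunc_le_const_mul_sq` (`≤ (1 + G(e₂)⁻²)·G(x)²` for ALL `x`),
  `energyGapPowerLawWithoutPosKappa_holds`: the crux with `0 < κ` weakened to `0 ≤ κ` is a theorem.
  So the hypothesis `0 < κ` carries ALL the content.
* §4 **LOAD-BEARING `x ≠ 0`** — `energyGapPowerLaw_false_without_neZero`: with `x = 0` admitted the
  statement is FALSE (`0^{-κ} = 0` kills the right side while `T(0) = 1 − G(e₂)² > 0`).  Harmless for
  the intended statement; `(1+‖x‖)^{-κ}` would be the x=0-safe variant.
* §5 reductions — `energyTrunc_nonneg` (GKS II), `energyGapPowerLaw_iff_eventually` (ONLY LARGE `‖x‖`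
  MATTERS), `energyGapSoft_of_energyGapPowerLaw` (crux ⇒ support item `EnergyGapSoft`, stmt-4473).
* §6 barrier reduction — `energyTrunc_treeBound_allDim`, `energyGapKappaZero_dimensionUniform`: the
  `κ = 0` bound holds verbatim on `ℤ^d` for EVERY `d ≥ 3`, i.e. it is dimension-uniform in the sense of
  `Literature.Barriers.CriticalPhenomena.IsingTrivialityFromDimensionFour`; granted that `κ = 0` is
  SHARP for `d ≥ 5`, no dimension-uniform argument proves the crux: a proof must consume a `d = 3`
  input at least as strong as `B(β_c) = ∞` (DCP25 Thm 1.8), and (the `d = 4` twin: bubble divergent,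
  GAP predicted false with logs, `EnergyGapSoft` true) in fact a QUANTITATIVE `d = 3` input that fails
  on `ℤ⁴` — per-scale merging `q_k ≥ q > 0` on a positive density of scales, not mere divergence.
* §7 **(cycle 2) A RIGOROUS LOWER ENVELOPE** — gen 1 recorded "the only rigorous lower bound on `T` is
  GKS II (`≥ 0`)"; this is now sharpened.  With the provers' infinite-volume factorisation
  `T = G(x)²A_par + G(x+e₂)G(x−e₂)A_cross` (`adjacentTruncation_eq`, ADC21 (3.11); `A_par`, `A_cross`
  the avoidance probabilities of the two independent critical sourced currents for the parallel /
  crossed pairing of the far targets, `Apar`, `Across` below) and the TIED PAIRINGS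
  `G(x)²P_par = G(x+e₂)G(x−e₂)P_cross` (`pairings_tied_par`, Aizenman's identity for two labellings of
  the symmetric `U₄`), one gets `G²A_par − G₊G₋A_cross = G² − G₊G₋`
  (`sq_mul_Apar_sub_crossed_mul_Across`) and hence
  **`|G(x)² − G(x+e₂)G(x−e₂)| ≤ T(x)`** for every `x` (`abs_sq_sub_crossed_le_energyTrunc`), i.e.
  `|s(x) − 1| ≤ T(x)/G(x)²` for the SECOND RATIO `s(x) = G(x+e₂)G(x−e₂)/G(x)²`
  (`abs_secondRatio_sub_one_le`; `s ∈ [G(e₂)², G(e₂)⁻²]` always, `secondRatio_mem_Icc`).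
  Consequence: **GAP ⇒ `SecondRatioPowerRegular`** (`|s(x) − 1| ≤ C‖x‖^{-κ}` for all `x ≠ 0`,
  uniformly in the direction; `secondRatioPowerRegular_of_energyGapPowerLaw`) — a statement about
  the critical TWO-point function alone whose SOFT form `s → 1` is open off the lattice axes (the
  tree has it only along an axis, `criticalTwoPoint_axis_ratio_tendsto_one`, and from the crux
  `MoebiusLimit`, which carries no rate).  The disproof handle this opens,
  `not_energyGapPowerLaw_of_not_secondRatioPowerRegular`, is predicted NOT to fire
  (`s − 1 ≈ ∂₂² log G ~ (1+η)‖x‖⁻² ≪ ‖x‖^{-0.75}`), but it is the ONLY negative route that does not need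
  a lower bound on a current-avoidance probability.
* §8 **(cycle 2) EXACT POWER REFORMULATIONS** — `energyGapPowerLaw_iff_adjacentAvoidancePowerLaw`:
  GAP ⟺ BOTH adjacent avoidance probabilities decay as a power (`A_par, A_cross ≤ C‖x‖^{-κ}`), the
  power twin of the provers' `energyGapSoft_iff_adjacentMerging`; and
  **`energyGapPowerLaw_iff_par_and_ratio`: GAP ⟺ `ParAvoidancePowerLaw ∧ SecondRatioPowerRegular`**
  (`T = 2G²A_par − (G² − G₊G₋)`, `energyTrunc_eq_two_mul_par_sub`).  Reading for the lines now in
  `Ideas/` (one-pinch reductions "any κ will do, bound one pairing"): a proof that bounds ONLY the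
  parallel avoidance closes the crux iff it ALSO proves power-rate second-ratio regularity of `G`
  in all directions; a proof that bounds both pairings proves that regularity as a by-product.
  Either way every proof of GAP contains a power-rate two-point regularity theorem on `ℤ³` that no
  item of the route supplies (`MoebiusLimit` gives `s → 1` without rate) — an implicit second crux.
* §9 **(cycle 2) THE AXIS `x = n e₂` IS A CERTIFIED DEAD END FOR TWO-POINT LOWER BOUNDS** — by
  reflection-positivity log-convexity (`criticalTwoPoint_axis_sq_le`) the axis ratios
  `r_k = G((k+1)e₂)/G(ke₂)` increase to `1` (`axRatio_mono`, `axRatio_le_one`), so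
  `s(ne₂) = r_n/r_{n−1} ≥ 1` (`one_le_secondRatio_ax`), the envelope is one-sided,
  `G(ne₂)²(s(ne₂) − 1) ≤ T(ne₂)` (`sq_mul_secondRatio_sub_one_le_energyTrunc_ax`), and the defects
  TELESCOPE: **`∑_{n=1}^{N} (s(ne₂) − 1) ≤ r_N/r_0 − 1 ≤ G(e₂)⁻¹ − 1`** for every `N`
  (`sum_secondRatio_ax_sub_one_le`).  A summable sequence is below `n^{-κ}` for `κ ≤ 1` along a
  density-one set, so NO lower bound on `T` obtainable from the two-point function on the axis can
  contradict any `κ ≤ 1`: the negation of the crux on the axis is purely a statement about sourced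
  currents.  Conversely GAP forces the quantitative log-convexity defect
  `G((n+1)e₂)G((n−1)e₂) ≤ (1 + Cn^{-κ})G(ne₂)²` (`axis_logConvexityDefect_of_energyGapPowerLaw`), open
  even on the axis (the tree's `CriticalAxisRatioRegularity`: "only the RATE is open").

## Attacks tried → outcome

Cycle 1 (gen 1): elaboration / junk audit → clean; trivial tactics → no; degenerate instances
`x = 0` (load-bearing, §4), `x = ±e₂` (absorbed), `κ → 0⁺` (boundary theorem §3); strengthenings
`κ > 1`, `∀ d ≥ 3`, exponential gap → none Lean-refutable (each needs a lower bound on `T` at `β_c(3)`);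
literature search (no printed `Δ_ε = 2Δ_σ` claim on `ℤ³`; Hasenbusch 2018 supports the power law);
SW calibration job j005391 (owned by the gen-1 seat; its summary never reached the item).
Cycle 2 (gen 2): (i) lower-envelope attack via the tied pairings → §7 (new rigorous lower bound, no
contradiction: predicted `|s−1| ~ ‖x‖⁻²`); (ii) RP / transfer-matrix attack on the axis → §9 (defects
summable: certified dead end); (iii) exact power reformulation → §8 (isolates the implicit two-point
crux); (iv) hypothesis mutation "drop `β = β_c`": at `β = 0` the crux holds trivially (`T ≡ 0` off
`{0, ±e₂}`), for `β > β_c` it holds by `G² ≥ m*⁴ > 0` and exponential clustering of the plus state,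
for `0 < β < β_c` it is predicted FALSE (`κ = 0` sharp: OZ decay `T ≍ G²`) but, like `d ≥ 5`, not
Lean-refutable without an avoidance LOWER bound — so `β_c` is load-bearing only through the content,
not through any junk; (v) the four crux ideas (`Ideas/*.md`) were read against §7–§8: the one-pinch
reductions (markov-square-root-one-ended-hole, neighbouring-iic-avoidance) are consistent with §8 but
inherit the implicit two-point crux unless they bound both pairings; (vi) `ledger negatives` and the
barrier catalogue re-checked: no entry bites.

## Near-misses (not sorried, recorded only)

* `¬ (∀ d ≥ 3, EnergyGapPowerLawIn d)` — blocked on a `d ≥ 5` lower bound `T ≥ c·G(x)²` (positive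
  avoidance of two ADJACENT sourced critical currents when `B(β_c) < ∞`); Aizenman's tree-diagram
  bound is useless at adjacent sources (the `u ≈ 0` terms are `O(1)`), and §7's envelope gives only
  `G²|s − 1|`, which is small in every dimension.
* `κ ≤ 1` ceiling modulo `∑_x T(x) = ∞` (infinite specific heat AT `β_c(3)`, predicted since `α > 0`):
  with the infrared bound `G ≤ C‖x‖⁻¹`, GAP with `κ > 1` would make `T` summable.  Conditional only
  (the divergence is not in the tree); not filed.
* `criticalTwoPoint 3 e₂`, `criticalBeta 3` have no numerical enclosure in the tree, so no
  constant-level strengthening (e.g. `C = 1`) can be tested.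
-/
noncomputable section

namespace Summit.CriticalPhenomena.Ising3DConformalLimit.Cruxes.EnergyGapPowerLaw.Disproof

open Literature.Probability.LatticeModels Literature.Probability.Percolation Filter Topology Finset
open scoped symmDiff
open MeasureTheory
open Summit.CriticalPhenomena.Ising3DConformalLimit.Theses.EnergyNotSigmaSquared
  (EnergyGapPowerLaw EnergyGapSoft)
open Summit.CriticalPhenomena.Ising3DConformalLimit.EnergyNotSigmaSquaredEnergyGapSoft
  (adjacentTruncation_eq sourcedDoubleCurrentLawInf_real_le_one
   one_sub_sourcedDoubleCurrentLawInf_real_nonneg crossedPairing_comparable)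
open Summit.CriticalPhenomena.Ising3DConformalLimit.EnergyNotSigmaSquaredGapForcesFarMerging
  (criticalCorr_four_swap12 criticalCorr_four_swap23)

/-! ## §0. The crux, unfolded -/

/-- The lattice vector `e₂ = (0,1,0) ∈ ℤ³` of the crux (`Pi.single 1 1`). -/
abbrev e₂ : Site 3 := Pi.single 1 1

/-- The truncated energy–energy correlation of the crux,
`⟨σ₀σ_{e₂}σ_xσ_{x+e₂}⟩_{β_c} - ⟨σ₀σ_{e₂}⟩_{β_c}⟨σ_xσ_{x+e₂}⟩_{β_c}` on `ℤ³`. -/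
def energyTrunc (x : Site 3) : ℝ :=
  criticalCorr 3 4 ![0, e₂, x, x + e₂] - criticalCorr 3 2 ![0, e₂] * criticalCorr 3 2 ![x, x + e₂]

/-- The crux verbatim, in the notation of this file (definitional unfolding, `Iff.rfl`). -/
theorem energyGapPowerLaw_iff :
    EnergyGapPowerLaw ↔ ∃ κ C : ℝ, 0 < κ ∧ ∀ x : Site 3, x ≠ 0 →
      energyTrunc x ≤ C * (‖x‖ : ℝ) ^ (-κ) * criticalTwoPoint 3 x ^ 2 :=
  Iff.rfl

/-! ## §1. Lebowitz' inequality in the critical state of `ℤ^d`, `d ≥ 3` -/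

/-- **`U₄ ≤ 0` for the critical correlators** (`criticalCorr d`, `d ≥ 3`): Lebowitz' inequality
`lebowitz_holds` in the free-boundary boxes, passed to the limit along
`criticalCorr_wellDefined_holds` (the free box expectations converge to the critical state). -/
theorem criticalU4_nonpos {d : ℕ} (hd : 3 ≤ d) (y : Fin 4 → Site d) :
    criticalCorr d 4 y - (criticalCorr d 2 ![y 0, y 1] * criticalCorr d 2 ![y 2, y 3]
      + criticalCorr d 2 ![y 0, y 2] * criticalCorr d 2 ![y 1, y 3]
      + criticalCorr d 2 ![y 0, y 3] * criticalCorr d 2 ![y 1, y 2]) ≤ 0 := by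
  classical
  set β := criticalBeta d with hβdef
  have hβ : 0 ≤ β := criticalBeta_nonneg d
  have hconv_n : ∀ {n : ℕ} (z : Fin n → Site d), Tendsto
      (fun L : ℕ => nPoint (isingMeasure (zdGraph d) (box d L) β 0 .free) spinAt z) atTop
      (𝓝 (criticalCorr d n z)) := fun z =>
    criticalCorr_wellDefined_holds (d := d) hd _ z .free (by simp)
  have hconv_2 : ∀ a b : Site d, Tendsto
      (fun L : ℕ => twoPoint (isingMeasure (zdGraph d) (box d L) β 0 .free) spinAt a b) atTop
      (𝓝 (criticalCorr d 2 ![a, b])) := by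
    intro a b
    have h := hconv_n ![a, b]
    simp only [nPoint, Fin.prod_univ_two, Matrix.cons_val_zero, Matrix.cons_val_one] at h
    exact h
  have hconv : Tendsto (fun L : ℕ => connectedFour (isingMeasure (zdGraph d) (box d L) β 0 .free)
      spinAt y) atTop (𝓝 (criticalCorr d 4 y - (criticalCorr d 2 ![y 0, y 1] *
        criticalCorr d 2 ![y 2, y 3] + criticalCorr d 2 ![y 0, y 2] * criticalCorr d 2 ![y 1, y 3]
        + criticalCorr d 2 ![y 0, y 3] * criticalCorr d 2 ![y 1, y 2]))) := by
    have h := (((hconv_n y).sub ((hconv_2 (y 0) (y 1)).mul (hconv_2 (y 2) (y 3)))).sub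
      ((hconv_2 (y 0) (y 2)).mul (hconv_2 (y 1) (y 3)))).sub
      ((hconv_2 (y 0) (y 3)).mul (hconv_2 (y 1) (y 2)))
    have he : criticalCorr d 4 y - (criticalCorr d 2 ![y 0, y 1] *
        criticalCorr d 2 ![y 2, y 3] + criticalCorr d 2 ![y 0, y 2] * criticalCorr d 2 ![y 1, y 3]
        + criticalCorr d 2 ![y 0, y 3] * criticalCorr d 2 ![y 1, y 2]) =
        criticalCorr d 4 y - criticalCorr d 2 ![y 0, y 1] * criticalCorr d 2 ![y 2, y 3]
        - criticalCorr d 2 ![y 0, y 2] * criticalCorr d 2 ![y 1, y 3]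
        - criticalCorr d 2 ![y 0, y 3] * criticalCorr d 2 ![y 1, y 2] := by ring
    rw [he]
    exact h
  obtain ⟨L₀, hL₀⟩ := exists_forall_subset_box d (Finset.univ.image y)
  have hybox : ∀ L, L₀ ≤ L → ∀ i, y i ∈ box d L := fun L hL i =>
    hL₀ L hL (Finset.mem_image_of_mem y (Finset.mem_univ i))
  refine le_of_tendsto hconv ?_
  filter_upwards [eventually_ge_atTop L₀] with L hL
  exact lebowitz_holds (zdGraph d) hβ (box d L) y (hybox L hL)

/-- Lebowitz' inequality for four named critical points (the form consumed below). -/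
theorem criticalU4_nonpos' {d : ℕ} (hd : 3 ≤ d) (a b c e : Site d) :
    criticalCorr d 4 ![a, b, c, e] - (criticalCorr d 2 ![a, b] * criticalCorr d 2 ![c, e]
      + criticalCorr d 2 ![a, c] * criticalCorr d 2 ![b, e]
      + criticalCorr d 2 ![a, e] * criticalCorr d 2 ![b, c]) ≤ 0 :=
  criticalU4_nonpos hd ![a, b, c, e]

/-! ## §2. Dictionary: pair correlators, positivity, GKS II -/

/-- `σ_aσ_b = σ_{{a} ∆ {b}}` as observables (repetition allowed). -/
theorem spinMonomial_two_eq_spinProduct {V : Type*} [DecidableEq V] (a b : V) :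
    spinMonomial ![a, b] = spinProduct ({a} ∆ {b}) := by
  funext σ
  rw [spinProduct_singleton_symmDiff]
  simp [spinMonomial, spinProduct, Fin.prod_univ_two]

/-- The critical pair correlator is a plus-state set correlation. -/
theorem criticalCorr_two_eq_plusCorr {d : ℕ} (a b : Site d) :
    criticalCorr d 2 ![a, b] = plusCorr d (criticalBeta d) 0 ({a} ∆ {b}) := by
  change plusExpect d (criticalBeta d) 0 (spinMonomial ![a, b]) =
    plusExpect d (criticalBeta d) 0 (spinProduct ({a} ∆ {b}))
  rw [spinMonomial_two_eq_spinProduct]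

/-- The critical four-point correlator is a plus-state set correlation. -/
theorem criticalCorr_four_eq_plusCorr {d : ℕ} (a b c e : Site d) :
    criticalCorr d 4 ![a, b, c, e] = plusCorr d (criticalBeta d) 0 ({a} ∆ ({b} ∆ ({c} ∆ {e}))) := by
  change plusExpect d (criticalBeta d) 0 (spinMonomial ![a, b, c, e]) =
    plusExpect d (criticalBeta d) 0 (spinProduct ({a} ∆ ({b} ∆ ({c} ∆ {e}))))
  rw [spinMonomial_four_eq_spinProduct]

/-- **GKS II for the critical two-point function**: `G(x+v)·G(v) ≤ G(x)` on `ℤ^d`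
(`plusCorr_mul_le` and translation invariance through `criticalCorr_two_pair`). -/
theorem criticalTwoPoint_add_mul_le {d : ℕ} (x v : Site d) :
    criticalTwoPoint d (x + v) * criticalTwoPoint d v ≤ criticalTwoPoint d x := by
  have h1 : criticalTwoPoint d (x + v) = plusCorr d (criticalBeta d) 0 ({0} ∆ {x + v}) := by
    rw [← criticalCorr_two_eq_plusCorr, criticalCorr_two_pair, sub_zero]
  have h2 : criticalTwoPoint d v = plusCorr d (criticalBeta d) 0 ({x + v} ∆ {x}) := by
    rw [← criticalCorr_two_eq_plusCorr, criticalCorr_two_pair, ← criticalTwoPoint_neg]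
    congr 1; abel
  have h3 : criticalTwoPoint d x = plusCorr d (criticalBeta d) 0 ({0} ∆ {x}) := by
    rw [← criticalCorr_two_eq_plusCorr, criticalCorr_two_pair, sub_zero]
  rw [h1, h2, h3]
  have h := plusCorr_mul_le (d := d) (criticalBeta_nonneg d) le_rfl ({0} ∆ {x + v}) ({x + v} ∆ {x})
  have hs : (({0} : Finset (Site d)) ∆ {x + v}) ∆ ({x + v} ∆ {x}) = {0} ∆ {x} := by
    rw [symmDiff_assoc, symmDiff_symmDiff_cancel_left]
  rwa [hs] at h

/-- `e₂ ≠ 0`. -/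
theorem e₂_ne_zero : (e₂ : Site 3) ≠ 0 := by
  intro h
  have := congrFun h 1
  simp at this

/-- `‖e₂‖ = 1` (sup norm). -/
theorem norm_e₂ : ‖(e₂ : Site 3)‖ = 1 := by
  rw [show (e₂ : Site 3) = Pi.single 1 1 from rfl, Pi.norm_single]
  simp

/-- `G(e₂) > 0` at `β_c(3)` (Simon–Lieb lower bound of `criticalTwoPoint_bounds_holds`). -/
theorem criticalTwoPoint_e₂_pos : 0 < criticalTwoPoint 3 e₂ := by
  obtain ⟨c, C, hc, h⟩ := criticalTwoPoint_bounds_holds (d := 3) (by norm_num)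
  have h1 := (h e₂ e₂_ne_zero).1
  rw [norm_e₂, Real.one_rpow, mul_one] at h1
  exact hc.trans_le h1

/-- `G(x) > 0` for every `x ∈ ℤ³` at `β_c(3)`. -/
theorem criticalTwoPoint_pos (x : Site 3) : 0 < criticalTwoPoint 3 x := by
  by_cases hx : x = 0
  · rw [hx, criticalTwoPoint_zero']; exact one_pos
  obtain ⟨c, C, hc, h⟩ := criticalTwoPoint_bounds_holds (d := 3) (by norm_num)
  have h1 := (h x hx).1
  have hn : 0 < ‖x‖ := norm_pos_iff.mpr hx
  exact lt_of_lt_of_le (by positivity) h1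

/-! ## §3. The boundary case `κ = 0` HOLDS (tree bound): the content of the crux is `0 < κ` -/

/-- **Lebowitz for the energy pair**: `⟨ε₀;ε_x⟩ ≤ G(x)² + G(x+e₂)·G(x−e₂)` for every `x ∈ ℤ³`. -/
theorem energyTrunc_le_pairings (x : Site 3) :
    energyTrunc x ≤ criticalTwoPoint 3 x ^ 2 + criticalTwoPoint 3 (x + e₂) * criticalTwoPoint 3 (x - e₂) := by
  have h := criticalU4_nonpos' (d := 3) (by norm_num) 0 e₂ x (x + e₂)
  rw [criticalCorr_two_pair 0 x, criticalCorr_two_pair e₂ (x + e₂), criticalCorr_two_pair 0 (x + e₂),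
    criticalCorr_two_pair e₂ x] at h
  simp only [sub_zero, add_sub_cancel_right] at h
  unfold energyTrunc
  nlinarith [h]

/-- `G(x+e₂)·G(x−e₂) ≤ G(e₂)⁻² · G(x)²` (GKS II twice). -/
theorem shifted_pair_le (x : Site 3) :
    criticalTwoPoint 3 (x + e₂) * criticalTwoPoint 3 (x - e₂) ≤
      (criticalTwoPoint 3 e₂ ^ 2)⁻¹ * criticalTwoPoint 3 x ^ 2 := by
  have hpos := criticalTwoPoint_e₂_pos
  have h1 : criticalTwoPoint 3 (x + e₂) * criticalTwoPoint 3 e₂ ≤ criticalTwoPoint 3 x :=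
    criticalTwoPoint_add_mul_le x e₂
  have h2 : criticalTwoPoint 3 (x - e₂) * criticalTwoPoint 3 e₂ ≤ criticalTwoPoint 3 x := by
    have h := criticalTwoPoint_add_mul_le x (-e₂)
    rwa [criticalTwoPoint_neg, ← sub_eq_add_neg] at h
  have ha : 0 ≤ criticalTwoPoint 3 (x + e₂) := criticalTwoPoint_nonneg' _
  have hb : 0 ≤ criticalTwoPoint 3 (x - e₂) := criticalTwoPoint_nonneg' _
  rw [← div_eq_inv_mul, le_div_iff₀ (by positivity)]
  calc criticalTwoPoint 3 (x + e₂) * criticalTwoPoint 3 (x - e₂) * criticalTwoPoint 3 e₂ ^ 2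
      = (criticalTwoPoint 3 (x + e₂) * criticalTwoPoint 3 e₂) *
          (criticalTwoPoint 3 (x - e₂) * criticalTwoPoint 3 e₂) := by ring
    _ ≤ criticalTwoPoint 3 x * criticalTwoPoint 3 x :=
        mul_le_mul h1 h2 (by positivity) (criticalTwoPoint_nonneg' _)
    _ = criticalTwoPoint 3 x ^ 2 := by ring

/-- **Tree bound with an explicit constant**: `⟨ε₀;ε_x⟩ ≤ (1 + G(e₂)⁻²)·G(x)²` for EVERY `x`
(including `x = 0`). -/
theorem energyTrunc_le_const_mul_sq (x : Site 3) :
    energyTrunc x ≤ (1 + (criticalTwoPoint 3 e₂ ^ 2)⁻¹) * criticalTwoPoint 3 x ^ 2 := by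
  have h1 := energyTrunc_le_pairings x
  have h2 := shifted_pair_le x
  nlinarith [h1, h2]

/-- The crux with its exponent hypothesis `0 < κ` weakened to `0 ≤ κ`. -/
def EnergyGapPowerLawWithoutPosKappa : Prop :=
  ∃ κ C : ℝ, 0 ≤ κ ∧ ∀ x : Site 3, x ≠ 0 →
    energyTrunc x ≤ C * (‖x‖ : ℝ) ^ (-κ) * criticalTwoPoint 3 x ^ 2

/-- **Boundary case**: with `0 ≤ κ` in place of `0 < κ` the crux HOLDS (take `κ = 0`; Lebowitz +
GKS II + Simon–Lieb positivity of `G(e₂)`). Hence every bit of content of `EnergyGapPowerLaw` is in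
the strict positivity of the exponent — "ε is not σ²" is exactly `κ > 0`. -/
theorem energyGapPowerLawWithoutPosKappa_holds : EnergyGapPowerLawWithoutPosKappa := by
  refine ⟨0, 1 + (criticalTwoPoint 3 e₂ ^ 2)⁻¹, le_rfl, fun x _ => ?_⟩
  rw [neg_zero, Real.rpow_zero, mul_one]
  exact energyTrunc_le_const_mul_sq x

/-! ## §4. Load-bearing hypothesis `x ≠ 0`: dropping it makes the crux FALSE -/

/-- GKS II in the other direction: `G(x)·G(v) ≤ G(x+v)`. -/
theorem criticalTwoPoint_mul_le_add {d : ℕ} (x v : Site d) :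
    criticalTwoPoint d x * criticalTwoPoint d v ≤ criticalTwoPoint d (x + v) := by
  have h := criticalTwoPoint_add_mul_le (x + v) (-v)
  rwa [add_neg_cancel_right, criticalTwoPoint_neg] at h

/-- `⟨σ₀σ_{e₂}σ₀σ_{e₂}⟩_{β_c} = ⟨1⟩ = 1` (the spin monomial at `(0, e₂, 0, e₂)` is the empty
spin product). -/
theorem criticalCorr_four_zero : criticalCorr 3 4 ![0, e₂, 0, e₂] = 1 := by
  rw [criticalCorr_four_eq_plusCorr]
  have hs : (({0} : Finset (Site 3)) ∆ ({e₂} ∆ ({0} ∆ {e₂}))) = ∅ := by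
    rw [symmDiff_left_comm ({e₂} : Finset (Site 3)) {0} {e₂}, symmDiff_self, symmDiff_bot,
      symmDiff_self, Finset.bot_eq_empty]
  rw [hs]
  exact plusCorr_empty (criticalBeta_nonneg 3) le_rfl

/-- At the excluded point: `⟨ε₀;ε₀⟩ = 1 - G(e₂)²`. -/
theorem energyTrunc_zero : energyTrunc 0 = 1 - criticalTwoPoint 3 e₂ ^ 2 := by
  simp only [energyTrunc, zero_add]
  rw [criticalCorr_four_zero, criticalCorr_two_pair, sub_zero]
  ring

/-- `G(e₂) < 1` at `β_c(3)`: otherwise GKS II gives `G(n e₂) = 1` for all `n`, against the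
infrared bound `G(v) ≤ C‖v‖⁻¹` (`criticalTwoPoint_bounds_holds`). -/
theorem criticalTwoPoint_e₂_lt_one : criticalTwoPoint 3 e₂ < 1 := by
  by_contra hge
  push Not at hge
  have h1 : criticalTwoPoint 3 e₂ = 1 := le_antisymm (criticalTwoPoint_le_one' _) hge
  have hall : ∀ n : ℕ, criticalTwoPoint 3 ((n : ℤ) • e₂) = 1 := by
    intro n
    induction n with
    | zero => simp [criticalTwoPoint_zero']
    | succ n ih =>
      refine le_antisymm (criticalTwoPoint_le_one' _) ?_
      have h := criticalTwoPoint_mul_le_add ((n : ℤ) • e₂) e₂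
      rw [ih, h1, one_mul] at h
      have he : ((n : ℤ) • e₂ + e₂ : Site 3) = ((n + 1 : ℕ) : ℤ) • e₂ := by
        push_cast
        rw [add_zsmul, one_zsmul]
      rwa [he] at h
  obtain ⟨c, C, -, hb⟩ := criticalTwoPoint_bounds_holds (d := 3) (by norm_num)
  obtain ⟨n, hn⟩ := exists_nat_gt (max C 1)
  have hn1 : (1 : ℝ) < n := (le_max_right _ _).trans_lt hn
  have hnC : C < n := (le_max_left _ _).trans_lt hn
  have hnpos : (0 : ℝ) < n := by linarith
  set v : Site 3 := (n : ℤ) • e₂ with hvdef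
  have hv : v = Pi.single 1 (n : ℤ) := by
    ext j
    simp only [hvdef, Pi.smul_apply, smul_eq_mul, Pi.single_apply]
    split_ifs <;> simp
  have hv0 : v ≠ 0 := by
    intro h0
    have := congrFun h0 1
    rw [hv] at this
    simp at this
    have : (n : ℝ) = 0 := by exact_mod_cast this
    linarith
  have hnorm : ‖v‖ = n := by
    rw [hv, Pi.norm_single, Int.norm_natCast]
  have hup := (hb v hv0).2
  rw [hnorm, hall n] at hup
  have hexp : (n : ℝ) ^ (-(((3 : ℕ) : ℝ) - 2)) = (n : ℝ)⁻¹ := by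
    norm_num [Real.rpow_neg_one]
  rw [hexp] at hup
  -- `1 ≤ C / n` with `n > C`, `n > 1`: contradiction
  have : (n : ℝ) ≤ C := by
    have h := mul_le_mul_of_nonneg_right hup hnpos.le
    rw [one_mul, mul_assoc, inv_mul_cancel₀ hnpos.ne', mul_one] at h
    exact h
  linarith

/-- The crux with the side condition `x ≠ 0` dropped. -/
def EnergyGapPowerLawWithoutNeZero : Prop :=
  ∃ κ C : ℝ, 0 < κ ∧ ∀ x : Site 3,
    energyTrunc x ≤ C * (‖x‖ : ℝ) ^ (-κ) * criticalTwoPoint 3 x ^ 2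

/-- **Any proof must use `x ≠ 0`** (if only to discard one point): at `x = 0` the right-hand
side is `C · 0^{-κ} · 1 = 0` (`Real.zero_rpow`) while the left-hand side is `1 - G(e₂)² > 0`. -/
theorem energyGapPowerLaw_false_without_neZero : ¬ EnergyGapPowerLawWithoutNeZero := by
  rintro ⟨κ, C, hκ, h⟩
  have h0 := h 0
  rw [norm_zero, Real.zero_rpow (by linarith), mul_zero, zero_mul, energyTrunc_zero] at h0
  have hlt := criticalTwoPoint_e₂_lt_one
  have hnn : 0 ≤ criticalTwoPoint 3 e₂ := criticalTwoPoint_nonneg' _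
  nlinarith

/-! ## §5. Reductions the provers may import -/

/-- `1 ≤ ‖x‖` for `x ≠ 0` in `ℤ³` (integer coordinates, sup norm). -/
theorem one_le_norm {x : Site 3} (hx : x ≠ 0) : 1 ≤ ‖x‖ := by
  obtain ⟨i, hi⟩ : ∃ i, x i ≠ 0 := by
    by_contra h
    push Not at h
    exact hx (funext h)
  calc (1 : ℝ) ≤ ‖x i‖ := by
        rw [Int.norm_eq_abs]
        exact_mod_cast Int.one_le_abs hi
    _ ≤ ‖x‖ := norm_le_pi_norm x i

/-- **GKS II**: the truncated energy correlation is nonnegative, so the one-sided crux is the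
same statement as its two-sided (`|·|`) version. -/
theorem energyTrunc_nonneg (x : Site 3) : 0 ≤ energyTrunc x := by
  unfold energyTrunc
  rw [criticalCorr_four_eq_plusCorr, criticalCorr_two_eq_plusCorr, criticalCorr_two_eq_plusCorr]
  have h := plusCorr_mul_le (d := 3) (criticalBeta_nonneg 3) le_rfl ({0} ∆ {e₂}) ({x} ∆ {x + e₂})
  rw [symmDiff_assoc] at h
  linarith

/-- The large-`‖x‖` form of the crux. -/
def EnergyGapPowerLawEventually : Prop :=
  ∃ κ C R : ℝ, 0 < κ ∧ ∀ x : Site 3, R ≤ ‖x‖ →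
    energyTrunc x ≤ C * (‖x‖ : ℝ) ^ (-κ) * criticalTwoPoint 3 x ^ 2

/-- **Only large `‖x‖` matters**: the crux is equivalent to its eventual form (small `x` are
absorbed into the constant through the tree bound of §3 and `1 ≤ ‖x‖`). -/
theorem energyGapPowerLaw_iff_eventually : EnergyGapPowerLaw ↔ EnergyGapPowerLawEventually := by
  rw [energyGapPowerLaw_iff]
  constructor
  · rintro ⟨κ, C, hκ, h⟩
    refine ⟨κ, C, 1, hκ, fun x hx => h x ?_⟩
    rintro rfl
    rw [norm_zero] at hx
    linarith
  · rintro ⟨κ, C, R, hκ, h⟩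
    set K := 1 + (criticalTwoPoint 3 e₂ ^ 2)⁻¹ with hK
    set R' := max R 1 with hR'
    have hK0 : 0 ≤ K := by positivity
    have hR'1 : 1 ≤ R' := le_max_right _ _
    have hR'pos : 0 < R' := by linarith
    refine ⟨κ, max C 0 + K * R' ^ κ, hκ, fun x hx => ?_⟩
    have hx1 : 1 ≤ ‖x‖ := one_le_norm hx
    have hxpos : 0 < ‖x‖ := by linarith
    have hG2 : 0 ≤ criticalTwoPoint 3 x ^ 2 := sq_nonneg _
    have hrpow : 0 ≤ ‖x‖ ^ (-κ) := Real.rpow_nonneg hxpos.le _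
    have hKR : 0 ≤ K * R' ^ κ := mul_nonneg hK0 (Real.rpow_nonneg hR'pos.le _)
    by_cases hR : R' ≤ ‖x‖
    · have h1 := h x ((le_max_left _ _).trans hR)
      have hC : C ≤ max C 0 + K * R' ^ κ := (le_max_left _ _).trans (le_add_of_nonneg_right hKR)
      calc energyTrunc x ≤ C * ‖x‖ ^ (-κ) * criticalTwoPoint 3 x ^ 2 := h1
        _ ≤ (max C 0 + K * R' ^ κ) * ‖x‖ ^ (-κ) * criticalTwoPoint 3 x ^ 2 := by
          gcongr
    · push Not at hR
      have h1 := energyTrunc_le_const_mul_sq x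
      have h2 : R' ^ (-κ) ≤ ‖x‖ ^ (-κ) :=
        Real.rpow_le_rpow_of_nonpos hxpos hR.le (by linarith)
      have h3 : K ≤ (max C 0 + K * R' ^ κ) * ‖x‖ ^ (-κ) := by
        calc K = K * R' ^ κ * R' ^ (-κ) := by
              rw [mul_assoc, ← Real.rpow_add hR'pos, add_neg_cancel, Real.rpow_zero, mul_one]
          _ ≤ K * R' ^ κ * ‖x‖ ^ (-κ) := by gcongr
          _ ≤ (max C 0 + K * R' ^ κ) * ‖x‖ ^ (-κ) := by
              gcongr
              exact le_add_of_nonneg_left (le_max_right _ _)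
      calc energyTrunc x ≤ K * criticalTwoPoint 3 x ^ 2 := h1
        _ ≤ (max C 0 + K * R' ^ κ) * ‖x‖ ^ (-κ) * criticalTwoPoint 3 x ^ 2 := by gcongr

/-- **GAP ⇒ soft gap**: the crux implies the route's support item `EnergyGapSoft`
(stmt-CriticalPhenomena-4473) — a consistency check of the two normalisations. -/
theorem energyGapSoft_of_energyGapPowerLaw (hgap : EnergyGapPowerLaw) : EnergyGapSoft := by
  obtain ⟨κ, C, hκ, h⟩ := hgap
  unfold EnergyGapSoft
  intro ε hε
  have hC0 : 0 ≤ max C 0 := le_max_right _ _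
  obtain ⟨R, hR1, hR⟩ : ∃ R : ℝ, 1 ≤ R ∧ max C 0 * R ^ (-κ) ≤ ε := by
    have ht : Tendsto (fun R : ℝ => max C 0 * R ^ (-κ)) atTop (𝓝 (max C 0 * 0)) :=
      (tendsto_rpow_neg_atTop hκ).const_mul _
    rw [mul_zero] at ht
    obtain ⟨R, h1, h2⟩ := ((ht.eventually (Iic_mem_nhds hε)).and (eventually_ge_atTop 1)).exists
    exact ⟨R, h2, h1⟩
  refine ⟨R, fun x hx => ?_⟩
  have hxpos : 0 < ‖x‖ := by linarith
  have hx0 : x ≠ 0 := by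
    rintro rfl
    rw [norm_zero] at hx
    linarith
  have h1 := h x hx0
  have h2 : C * ‖x‖ ^ (-κ) ≤ ε := by
    have ha : ‖x‖ ^ (-κ) ≤ R ^ (-κ) := Real.rpow_le_rpow_of_nonpos (by linarith) hx (by linarith)
    calc C * ‖x‖ ^ (-κ) ≤ max C 0 * ‖x‖ ^ (-κ) :=
          mul_le_mul_of_nonneg_right (le_max_left _ _) (Real.rpow_nonneg hxpos.le _)
      _ ≤ max C 0 * R ^ (-κ) := mul_le_mul_of_nonneg_left ha hC0
      _ ≤ ε := hR
  change energyTrunc x ≤ ε * criticalTwoPoint 3 x ^ 2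
  calc energyTrunc x ≤ C * ‖x‖ ^ (-κ) * criticalTwoPoint 3 x ^ 2 := h1
    _ ≤ ε * criticalTwoPoint 3 x ^ 2 := mul_le_mul_of_nonneg_right h2 (sq_nonneg _)


/-! ## §6. Barrier reduction: the `κ = 0` bound is DIMENSION-UNIFORM (`d ≥ 3`)

Every input of §3 (Lebowitz, GKS II, the Simon–Lieb lower bound making `G(eᵢ) > 0`, the
identification of the critical state as the common free/plus box limit) holds on `ℤ^d` for all
`d ≥ 3`, and so does the conclusion, verbatim.  In the vocabulary of
`Literature.Barriers.CriticalPhenomena.IsingTrivialityFromDimensionFour` (`DimensionUniform Φ :=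
∀ d ≥ 3, Φ d`) the tree bound is a dimension-uniform theorem; the crux (`κ > 0`) is predicted to
FAIL for `d ≥ 5` (bubble-convergent regime, `ε = :φ²:`, two adjacent sourced currents avoid each
other with positive probability), so — granted that prediction — no dimension-uniform argument
proves it: a proof of `EnergyGapPowerLaw` must consume a `d = 3` input (bubble divergence
`B(β_c) = ∞`, DCP25 Thm 1.8, or stronger).  The `d ≥ 5` failure itself is NOT in the tree (it needs
a lower bound `⟨ε₀;ε_x⟩ ≥ c·G(x)²`, i.e. uniformly positive avoidance of ADJACENT sourced currents,
which Aizenman's tree-diagram bound does not give at adjacent sources); recorded as a near-miss in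
the module docstring, not as a `sorry`. -/

/-- `G(eᵢ) > 0` at `β_c(d)` for every `d ≥ 3` (Simon–Lieb lower bound). -/
theorem criticalTwoPoint_single_pos {d : ℕ} (hd : 3 ≤ d) (i : Fin d) :
    0 < criticalTwoPoint d (Pi.single i 1) := by
  obtain ⟨c, C, hc, h⟩ := criticalTwoPoint_bounds_holds (d := d) hd
  have hne : (Pi.single i 1 : Site d) ≠ 0 := by
    intro h0
    have := congrFun h0 i
    simp at this
  have h1 := (h (Pi.single i 1) hne).1
  rw [Pi.norm_single, norm_one, Real.one_rpow, mul_one] at h1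
  exact hc.trans_le h1

/-- **The tree bound in every dimension `d ≥ 3`** (same proof as §3):
`⟨σ₀σ_{eᵢ};σ_xσ_{x+eᵢ}⟩_{β_c(d)} ≤ (1 + G(eᵢ)⁻²)·G(x)²` for all `x ∈ ℤ^d` and every axis `i`. -/
theorem energyTrunc_treeBound_allDim {d : ℕ} (hd : 3 ≤ d) (i : Fin d) (x : Site d) :
    criticalCorr d 4 ![0, Pi.single i 1, x, x + Pi.single i 1]
        - criticalCorr d 2 ![0, Pi.single i 1] * criticalCorr d 2 ![x, x + Pi.single i 1] ≤
      (1 + (criticalTwoPoint d (Pi.single i 1) ^ 2)⁻¹) * criticalTwoPoint d x ^ 2 := by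
  set e : Site d := Pi.single i 1 with hedef
  have hpos : 0 < criticalTwoPoint d e := criticalTwoPoint_single_pos hd i
  -- Lebowitz
  have h := criticalU4_nonpos' hd 0 e x (x + e)
  rw [criticalCorr_two_pair 0 x, criticalCorr_two_pair e (x + e), criticalCorr_two_pair 0 (x + e),
    criticalCorr_two_pair e x] at h
  simp only [sub_zero, add_sub_cancel_right] at h
  -- GKS II twice
  have h1 : criticalTwoPoint d (x + e) * criticalTwoPoint d e ≤ criticalTwoPoint d x :=
    criticalTwoPoint_add_mul_le x e
  have h2 : criticalTwoPoint d (x - e) * criticalTwoPoint d e ≤ criticalTwoPoint d x := by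
    have h := criticalTwoPoint_add_mul_le x (-e)
    rwa [criticalTwoPoint_neg, ← sub_eq_add_neg] at h
  have ha : 0 ≤ criticalTwoPoint d (x + e) := criticalTwoPoint_nonneg' _
  have hb : 0 ≤ criticalTwoPoint d (x - e) := criticalTwoPoint_nonneg' _
  have h3 : criticalTwoPoint d (x + e) * criticalTwoPoint d (x - e) ≤
      (criticalTwoPoint d e ^ 2)⁻¹ * criticalTwoPoint d x ^ 2 := by
    rw [← div_eq_inv_mul, le_div_iff₀ (by positivity)]
    calc criticalTwoPoint d (x + e) * criticalTwoPoint d (x - e) * criticalTwoPoint d e ^ 2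
        = (criticalTwoPoint d (x + e) * criticalTwoPoint d e) *
            (criticalTwoPoint d (x - e) * criticalTwoPoint d e) := by ring
      _ ≤ criticalTwoPoint d x * criticalTwoPoint d x :=
          mul_le_mul h1 h2 (by positivity) (criticalTwoPoint_nonneg' _)
      _ = criticalTwoPoint d x ^ 2 := by ring
  nlinarith [h, h3]

/-- The `κ = 0` form of the crux holds in EVERY dimension `d ≥ 3` (dimension-uniform theorem). -/
theorem energyGapKappaZero_dimensionUniform :
    ∀ d : ℕ, 3 ≤ d → ∀ i : Fin d, ∃ C : ℝ, ∀ x : Site d,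
      criticalCorr d 4 ![0, Pi.single i 1, x, x + Pi.single i 1]
          - criticalCorr d 2 ![0, Pi.single i 1] * criticalCorr d 2 ![x, x + Pi.single i 1] ≤
        C * criticalTwoPoint d x ^ 2 :=
  fun _ hd i => ⟨_, fun x => energyTrunc_treeBound_allDim hd i x⟩


/-! ## §7. A rigorous LOWER envelope: `|G(x)² − G(x+e₂)G(x−e₂)| ≤ ⟨ε₀;ε_x⟩` -/

/-- **The two cross pairings are tied** (Aizenman's identity ADC21 (3.11) for two labellings of the
permutation-symmetric `U₄(0,e₂,x,x+e₂)`; the provers' `pairings_tied`, reproved here to stay on the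
built import closure): `G(x)²·P_par(x) = G(x+e₂)G(x−e₂)·P_cross(x)`. -/
theorem pairings_tied_par (x : Site 3) :
    criticalTwoPoint 3 x ^ 2 *
        (sourcedDoubleCurrentLawInf 3 (criticalBeta 3) ({0} ∆ {x}) ({e₂} ∆ {x + e₂})).real (openConn 0 e₂) =
      criticalTwoPoint 3 (x + e₂) * criticalTwoPoint 3 (x - e₂) *
        (sourcedDoubleCurrentLawInf 3 (criticalBeta 3) ({0} ∆ {x + e₂}) ({e₂} ∆ {x})).real (openConn 0 e₂) := by
  have h1 := (freeUrsellFour_eq_sourcedDoubleCurrent_holds (d := 3)).criticalCorr_eq (by norm_num)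
    0 x e₂ (x + e₂)
  have h2 := (freeUrsellFour_eq_sourcedDoubleCurrent_holds (d := 3)).criticalCorr_eq (by norm_num)
    0 (x + e₂) e₂ x
  have e1 : criticalCorr 3 4 ![0, x, e₂, x + e₂] = criticalCorr 3 4 ![0, e₂, x, x + e₂] :=
    criticalCorr_four_swap12 _ _ _ _
  have e2' : criticalCorr 3 4 ![0, x + e₂, e₂, x] = criticalCorr 3 4 ![0, e₂, x, x + e₂] := by
    rw [criticalCorr_four_swap12, criticalCorr_four_swap23]
  rw [e1] at h1
  rw [e2'] at h2
  simp only [criticalCorr_two_pair, sub_zero, add_sub_cancel_right, add_sub_cancel_left,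
    sub_add_cancel_left, sub_add_cancel_right, criticalTwoPoint_neg] at h1 h2
  have e4 : criticalTwoPoint 3 (e₂ - x) = criticalTwoPoint 3 (x - e₂) := criticalTwoPoint_sub_comm _ _
  simp only [e4] at h1 h2
  nlinarith [h1, h2]

/-- Parallel adjacent avoidance `A_par(x) = 1 − P^{{0}∆{x},{e₂}∆{x+e₂}}_{β_c}[0 ↔ e₂]`. -/
def Apar (x : Site 3) : ℝ :=
  1 - (sourcedDoubleCurrentLawInf 3 (criticalBeta 3) ({0} ∆ {x}) ({e₂} ∆ {x + e₂})).real
    (openConn 0 e₂)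

/-- Crossed adjacent avoidance `A_cross(x) = 1 − P^{{0}∆{x+e₂},{e₂}∆{x}}_{β_c}[0 ↔ e₂]`. -/
def Across (x : Site 3) : ℝ :=
  1 - (sourcedDoubleCurrentLawInf 3 (criticalBeta 3) ({0} ∆ {x + e₂}) ({e₂} ∆ {x})).real
    (openConn 0 e₂)

theorem Apar_nonneg (x : Site 3) : 0 ≤ Apar x :=
  one_sub_sourcedDoubleCurrentLawInf_real_nonneg _ _ _ _

theorem Apar_le_one (x : Site 3) : Apar x ≤ 1 :=
  sub_le_self _ measureReal_nonneg

theorem Across_nonneg (x : Site 3) : 0 ≤ Across x :=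
  one_sub_sourcedDoubleCurrentLawInf_real_nonneg _ _ _ _

theorem Across_le_one (x : Site 3) : Across x ≤ 1 :=
  sub_le_self _ measureReal_nonneg

/-- The factorised truncation (provers' `adjacentTruncation_eq`, ADC21 (3.11) averaged over the two
cross pairings): `⟨ε₀;ε_x⟩ = G(x)²·A_par(x) + G(x+e₂)G(x−e₂)·A_cross(x)`. -/
theorem energyTrunc_eq_factorised (x : Site 3) :
    energyTrunc x = criticalTwoPoint 3 x ^ 2 * Apar x +
      criticalTwoPoint 3 (x + e₂) * criticalTwoPoint 3 (x - e₂) * Across x :=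
  adjacentTruncation_eq x

/-- The tied pairings in avoidance form: `G(x)²·A_par(x) − G(x+e₂)G(x−e₂)·A_cross(x) = G(x)² − G(x+e₂)G(x−e₂)`. -/
theorem sq_mul_Apar_sub_crossed_mul_Across (x : Site 3) :
    criticalTwoPoint 3 x ^ 2 * Apar x - criticalTwoPoint 3 (x + e₂) * criticalTwoPoint 3 (x - e₂) * Across x
      = criticalTwoPoint 3 x ^ 2 - criticalTwoPoint 3 (x + e₂) * criticalTwoPoint 3 (x - e₂) := by
  have h := pairings_tied_par x
  unfold Apar Across
  linear_combination -h

/-- **Lower envelope.** `|G(x)² − G(x+e₂)G(x−e₂)| ≤ ⟨ε₀;ε_x⟩` for every `x ∈ ℤ³`. -/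
theorem abs_sq_sub_crossed_le_energyTrunc (x : Site 3) :
    |criticalTwoPoint 3 x ^ 2 - criticalTwoPoint 3 (x + e₂) * criticalTwoPoint 3 (x - e₂)| ≤
      energyTrunc x := by
  rw [energyTrunc_eq_factorised, ← sq_mul_Apar_sub_crossed_mul_Across]
  have ha : 0 ≤ criticalTwoPoint 3 x ^ 2 * Apar x := mul_nonneg (sq_nonneg _) (Apar_nonneg x)
  have hb : 0 ≤ criticalTwoPoint 3 (x + e₂) * criticalTwoPoint 3 (x - e₂) * Across x :=
    mul_nonneg (mul_nonneg (criticalTwoPoint_nonneg' _) (criticalTwoPoint_nonneg' _)) (Across_nonneg x)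
  rw [abs_le]
  constructor <;> linarith

/-- Second ratio `s(x) = G(x+e₂)G(x−e₂)/G(x)²`. -/
def secondRatio (x : Site 3) : ℝ :=
  criticalTwoPoint 3 (x + e₂) * criticalTwoPoint 3 (x - e₂) / criticalTwoPoint 3 x ^ 2

theorem secondRatio_mem_Icc (x : Site 3) :
    secondRatio x ∈ Set.Icc (criticalTwoPoint 3 e₂ ^ 2) ((criticalTwoPoint 3 e₂ ^ 2)⁻¹) := by
  have hG2 : 0 < criticalTwoPoint 3 x ^ 2 := pow_pos (criticalTwoPoint_pos _) 2
  have hc : 0 < criticalTwoPoint 3 e₂ ^ 2 := pow_pos (criticalTwoPoint_pos _) 2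
  obtain ⟨h1, h2⟩ := crossedPairing_comparable x
  constructor
  · rw [secondRatio, le_div_iff₀ hG2]; exact h1
  · rw [secondRatio, div_le_iff₀ hG2, ← div_eq_inv_mul, le_div_iff₀ hc]
    exact h2

theorem abs_secondRatio_sub_one_le (x : Site 3) :
    |secondRatio x - 1| ≤ energyTrunc x / criticalTwoPoint 3 x ^ 2 := by
  have hG2 : 0 < criticalTwoPoint 3 x ^ 2 := pow_pos (criticalTwoPoint_pos _) 2
  have h := abs_sq_sub_crossed_le_energyTrunc x
  rw [secondRatio, div_sub_one hG2.ne', abs_div, abs_of_pos hG2, div_le_div_iff_of_pos_right hG2,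
    abs_sub_comm]
  exact h

/-- Power-rate second-ratio regularity of the critical two-point function (all directions). -/
def SecondRatioPowerRegular : Prop :=
  ∃ κ C : ℝ, 0 < κ ∧ ∀ x : Site 3, x ≠ 0 → |secondRatio x - 1| ≤ C * (‖x‖ : ℝ) ^ (-κ)

/-- **GAP ⇒ power-rate second-ratio regularity.** -/
theorem secondRatioPowerRegular_of_energyGapPowerLaw (h : EnergyGapPowerLaw) :
    SecondRatioPowerRegular := by
  obtain ⟨κ, C, hκ, hC⟩ := h
  refine ⟨κ, C, hκ, fun x hx => ?_⟩
  have hG2 : 0 < criticalTwoPoint 3 x ^ 2 := pow_pos (criticalTwoPoint_pos _) 2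
  have h1 := abs_secondRatio_sub_one_le x
  have h2 : energyTrunc x / criticalTwoPoint 3 x ^ 2 ≤ C * ‖x‖ ^ (-κ) := by
    rw [div_le_iff₀ hG2]
    exact hC x hx
  exact h1.trans h2

/-- The disproof handle it opens: failure of power-rate second-ratio regularity kills the crux. -/
theorem not_energyGapPowerLaw_of_not_secondRatioPowerRegular (h : ¬ SecondRatioPowerRegular) :
    ¬ EnergyGapPowerLaw :=
  fun hg => h (secondRatioPowerRegular_of_energyGapPowerLaw hg)

/-! ## §8. Exact power reformulations -/

def AdjacentAvoidancePowerLaw : Prop :=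
  ∃ κ C : ℝ, 0 < κ ∧ ∀ x : Site 3, x ≠ 0 →
    Apar x ≤ C * (‖x‖ : ℝ) ^ (-κ) ∧ Across x ≤ C * (‖x‖ : ℝ) ^ (-κ)

def ParAvoidancePowerLaw : Prop :=
  ∃ κ C : ℝ, 0 < κ ∧ ∀ x : Site 3, x ≠ 0 → Apar x ≤ C * (‖x‖ : ℝ) ^ (-κ)

/-- **GAP ⟺ both adjacent avoidance probabilities decay as a power.** -/
theorem energyGapPowerLaw_iff_adjacentAvoidancePowerLaw :
    EnergyGapPowerLaw ↔ AdjacentAvoidancePowerLaw := by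
  have hc : 0 < criticalTwoPoint 3 e₂ ^ 2 := pow_pos (criticalTwoPoint_pos _) 2
  rw [energyGapPowerLaw_iff]
  constructor
  · rintro ⟨κ, C, hκ, hC⟩
    refine ⟨κ, max C 0 * (criticalTwoPoint 3 e₂ ^ 2)⁻¹, hκ, fun x hx => ?_⟩
    have hx1 := one_le_norm hx
    have hG2 : 0 < criticalTwoPoint 3 x ^ 2 := pow_pos (criticalTwoPoint_pos _) 2
    have hr : 0 ≤ ‖x‖ ^ (-κ) := Real.rpow_nonneg (norm_nonneg _) _
    have hT := hC x hx
    rw [energyTrunc_eq_factorised] at hT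
    have ha : 0 ≤ criticalTwoPoint 3 x ^ 2 * Apar x := mul_nonneg hG2.le (Apar_nonneg x)
    have hP0 : 0 ≤ criticalTwoPoint 3 (x + e₂) * criticalTwoPoint 3 (x - e₂) :=
      mul_nonneg (criticalTwoPoint_nonneg' _) (criticalTwoPoint_nonneg' _)
    have hb : 0 ≤ criticalTwoPoint 3 (x + e₂) * criticalTwoPoint 3 (x - e₂) * Across x :=
      mul_nonneg hP0 (Across_nonneg x)
    have hCle : C * ‖x‖ ^ (-κ) ≤ max C 0 * ‖x‖ ^ (-κ) :=
      mul_le_mul_of_nonneg_right (le_max_left _ _) hr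
    have hinv1 : 1 ≤ (criticalTwoPoint 3 e₂ ^ 2)⁻¹ := by
      rw [one_le_inv₀ hc]
      exact pow_le_one₀ (criticalTwoPoint_nonneg' _) (criticalTwoPoint_le_one' _)
    have hM0 : 0 ≤ max C 0 * ‖x‖ ^ (-κ) := mul_nonneg (le_max_right _ _) hr
    have hup : max C 0 * ‖x‖ ^ (-κ) ≤ max C 0 * (criticalTwoPoint 3 e₂ ^ 2)⁻¹ * ‖x‖ ^ (-κ) := by
      calc max C 0 * ‖x‖ ^ (-κ) = max C 0 * 1 * ‖x‖ ^ (-κ) := by ring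
        _ ≤ max C 0 * (criticalTwoPoint 3 e₂ ^ 2)⁻¹ * ‖x‖ ^ (-κ) := by gcongr
    constructor
    · -- parallel: G² A_par ≤ T ≤ C‖x‖^{-κ} G²
      have h1 : criticalTwoPoint 3 x ^ 2 * Apar x ≤ criticalTwoPoint 3 x ^ 2 * (max C 0 * ‖x‖ ^ (-κ)) := by
        nlinarith
      exact (le_of_mul_le_mul_left h1 hG2).trans hup
    · -- crossed: G(e₂)² G² A_cross ≤ G₊G₋ A_cross ≤ T
      have hcross := (crossedPairing_comparable x).1
      have h1 : criticalTwoPoint 3 e₂ ^ 2 * criticalTwoPoint 3 x ^ 2 * Across x ≤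
          criticalTwoPoint 3 x ^ 2 * (max C 0 * ‖x‖ ^ (-κ)) := by
        calc criticalTwoPoint 3 e₂ ^ 2 * criticalTwoPoint 3 x ^ 2 * Across x
            ≤ criticalTwoPoint 3 (x + e₂) * criticalTwoPoint 3 (x - e₂) * Across x :=
              mul_le_mul_of_nonneg_right hcross (Across_nonneg x)
          _ ≤ criticalTwoPoint 3 x ^ 2 * (max C 0 * ‖x‖ ^ (-κ)) := by nlinarith
      have h2 : criticalTwoPoint 3 x ^ 2 * (criticalTwoPoint 3 e₂ ^ 2 * Across x) ≤
          criticalTwoPoint 3 x ^ 2 * (max C 0 * ‖x‖ ^ (-κ)) := by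
        calc _ = criticalTwoPoint 3 e₂ ^ 2 * criticalTwoPoint 3 x ^ 2 * Across x := by ring
          _ ≤ _ := h1
      have h3 := le_of_mul_le_mul_left h2 hG2
      rw [← le_div_iff₀' hc] at h3
      calc Across x ≤ max C 0 * ‖x‖ ^ (-κ) / criticalTwoPoint 3 e₂ ^ 2 := h3
        _ = max C 0 * (criticalTwoPoint 3 e₂ ^ 2)⁻¹ * ‖x‖ ^ (-κ) := by ring
  · rintro ⟨κ, C, hκ, hC⟩
    refine ⟨κ, C * (1 + (criticalTwoPoint 3 e₂ ^ 2)⁻¹), hκ, fun x hx => ?_⟩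
    obtain ⟨h1, h2⟩ := hC x hx
    have hG2 : 0 < criticalTwoPoint 3 x ^ 2 := pow_pos (criticalTwoPoint_pos _) 2
    have hP0 : 0 ≤ criticalTwoPoint 3 (x + e₂) * criticalTwoPoint 3 (x - e₂) :=
      mul_nonneg (criticalTwoPoint_nonneg' _) (criticalTwoPoint_nonneg' _)
    have hcross := (crossedPairing_comparable x).2
    have hPle : criticalTwoPoint 3 (x + e₂) * criticalTwoPoint 3 (x - e₂) ≤
        (criticalTwoPoint 3 e₂ ^ 2)⁻¹ * criticalTwoPoint 3 x ^ 2 := by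
      rw [← div_eq_inv_mul, le_div_iff₀ hc]; exact hcross
    have hCr : 0 ≤ C * ‖x‖ ^ (-κ) := (Apar_nonneg x).trans h1
    rw [energyTrunc_eq_factorised]
    calc criticalTwoPoint 3 x ^ 2 * Apar x + criticalTwoPoint 3 (x + e₂) * criticalTwoPoint 3 (x - e₂) * Across x
        ≤ criticalTwoPoint 3 x ^ 2 * (C * ‖x‖ ^ (-κ)) +
            (criticalTwoPoint 3 e₂ ^ 2)⁻¹ * criticalTwoPoint 3 x ^ 2 * (C * ‖x‖ ^ (-κ)) := by
          apply add_le_add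
          · exact mul_le_mul_of_nonneg_left h1 hG2.le
          · exact mul_le_mul hPle h2 (Across_nonneg x) (by positivity)
      _ = C * (1 + (criticalTwoPoint 3 e₂ ^ 2)⁻¹) * ‖x‖ ^ (-κ) * criticalTwoPoint 3 x ^ 2 := by ring

/-- The truncation as twice the parallel avoidance plus the second-ratio defect:
`⟨ε₀;ε_x⟩ = 2G(x)²A_par(x) − (G(x)² − G(x+e₂)G(x−e₂))`. -/
theorem energyTrunc_eq_two_mul_par_sub (x : Site 3) :
    energyTrunc x = 2 * (criticalTwoPoint 3 x ^ 2 * Apar x) -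
      (criticalTwoPoint 3 x ^ 2 - criticalTwoPoint 3 (x + e₂) * criticalTwoPoint 3 (x - e₂)) := by
  rw [energyTrunc_eq_factorised, ← sq_mul_Apar_sub_crossed_mul_Across]
  ring

/-- **GAP ⟺ (parallel adjacent avoidance decays as a power) ∧ (power-rate second-ratio regularity).** -/
theorem energyGapPowerLaw_iff_par_and_ratio :
    EnergyGapPowerLaw ↔ ParAvoidancePowerLaw ∧ SecondRatioPowerRegular := by
  constructor
  · intro h
    refine ⟨?_, secondRatioPowerRegular_of_energyGapPowerLaw h⟩
    obtain ⟨κ, C, hκ, hC⟩ := energyGapPowerLaw_iff_adjacentAvoidancePowerLaw.1 h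
    exact ⟨κ, C, hκ, fun x hx => (hC x hx).1⟩
  · rintro ⟨⟨κ₁, C₁, hκ₁, h₁⟩, ⟨κ₂, C₂, hκ₂, h₂⟩⟩
    rw [energyGapPowerLaw_iff]
    refine ⟨min κ₁ κ₂, 2 * max C₁ 0 + max C₂ 0, lt_min hκ₁ hκ₂, fun x hx => ?_⟩
    have hx1 := one_le_norm hx
    have hxpos : 0 < ‖x‖ := by linarith
    have hG2 : 0 < criticalTwoPoint 3 x ^ 2 := pow_pos (criticalTwoPoint_pos _) 2
    have hA := h₁ x hx
    have hS := h₂ x hx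
    -- compare the exponents
    have hr1 : ‖x‖ ^ (-κ₁) ≤ ‖x‖ ^ (-(min κ₁ κ₂)) :=
      Real.rpow_le_rpow_of_exponent_le hx1 (neg_le_neg (min_le_left _ _))
    have hr2 : ‖x‖ ^ (-κ₂) ≤ ‖x‖ ^ (-(min κ₁ κ₂)) :=
      Real.rpow_le_rpow_of_exponent_le hx1 (neg_le_neg (min_le_right _ _))
    have hr : 0 ≤ ‖x‖ ^ (-(min κ₁ κ₂)) := Real.rpow_nonneg hxpos.le _
    have hA' : Apar x ≤ max C₁ 0 * ‖x‖ ^ (-(min κ₁ κ₂)) :=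
      hA.trans ((mul_le_mul_of_nonneg_right (le_max_left _ _) (Real.rpow_nonneg hxpos.le _)).trans
        (mul_le_mul_of_nonneg_left hr1 (le_max_right _ _)))
    have hS' : |secondRatio x - 1| ≤ max C₂ 0 * ‖x‖ ^ (-(min κ₁ κ₂)) :=
      hS.trans ((mul_le_mul_of_nonneg_right (le_max_left _ _) (Real.rpow_nonneg hxpos.le _)).trans
        (mul_le_mul_of_nonneg_left hr2 (le_max_right _ _)))
    -- the defect `G² - G₊G₋ = G² (1 - s)` is at least `-G² |s-1|`
    have hdef : -(criticalTwoPoint 3 x ^ 2 - criticalTwoPoint 3 (x + e₂) * criticalTwoPoint 3 (x - e₂)) ≤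
        criticalTwoPoint 3 x ^ 2 * (max C₂ 0 * ‖x‖ ^ (-(min κ₁ κ₂))) := by
      have hs : criticalTwoPoint 3 (x + e₂) * criticalTwoPoint 3 (x - e₂) =
          secondRatio x * criticalTwoPoint 3 x ^ 2 := by
        rw [secondRatio, div_mul_cancel₀ _ hG2.ne']
      rw [hs]
      have h3 : secondRatio x - 1 ≤ max C₂ 0 * ‖x‖ ^ (-(min κ₁ κ₂)) := (le_abs_self _).trans hS'
      nlinarith
    rw [energyTrunc_eq_two_mul_par_sub]
    have h4 : criticalTwoPoint 3 x ^ 2 * Apar x ≤ criticalTwoPoint 3 x ^ 2 * (max C₁ 0 * ‖x‖ ^ (-(min κ₁ κ₂))) :=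
      mul_le_mul_of_nonneg_left hA' hG2.le
    nlinarith

/-! ## §9. The axis `x = n e₂`: log-convexity makes the lower envelope one-sided and SUMMABLE -/

/-- Axis points. -/
abbrev ax (n : ℕ) : Site 3 := Pi.single 1 (n : ℤ)

theorem ax_add_e₂ (n : ℕ) : ax n + e₂ = ax (n + 1) := by
  rw [ax, ax, ← Pi.single_add]; push_cast; rfl

theorem ax_succ_sub_e₂ (n : ℕ) : ax (n + 1) - e₂ = ax n := by
  rw [ax, ax, ← Pi.single_sub]; push_cast; simp

theorem ax_zero : ax 0 = 0 := by simp [ax]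

theorem ax_one : ax 1 = e₂ := by simp [ax]

/-- Axis ratios `r_k = G((k+1)e₂)/G(k e₂)`. -/
def axRatio (k : ℕ) : ℝ := criticalTwoPoint 3 (ax (k + 1)) / criticalTwoPoint 3 (ax k)

theorem axRatio_pos (k : ℕ) : 0 < axRatio k :=
  div_pos (criticalTwoPoint_pos _) (criticalTwoPoint_pos _)

theorem axRatio_zero : axRatio 0 = criticalTwoPoint 3 e₂ := by
  rw [axRatio, ax_one, ax_zero, criticalTwoPoint_zero', div_one]

/-- Log-convexity (reflection positivity): `r_k ≤ r_{k+1}` for all `k ≥ 0`. -/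
theorem axRatio_mono_succ (k : ℕ) : axRatio k ≤ axRatio (k + 1) := by
  have key := criticalTwoPoint_axis_sq_le (1 : Fin 3) (n := k + 1) (by omega)
  rw [show k + 1 - 1 = k by omega] at key
  have h0 := criticalTwoPoint_pos (ax k)
  have h1 := criticalTwoPoint_pos (ax (k + 1))
  rw [axRatio, axRatio, div_le_div_iff₀ h0 h1]
  change criticalTwoPoint 3 (ax (k+1)) ^ 2 ≤ criticalTwoPoint 3 (ax k) * criticalTwoPoint 3 (ax (k + 1 + 1)) at key
  nlinarith [key]

theorem axRatio_mono {j k : ℕ} (h : j ≤ k) : axRatio j ≤ axRatio k := by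
  induction h with
  | refl => exact le_rfl
  | step _ ih => exact ih.trans (axRatio_mono_succ _)

theorem axRatio_le_one (k : ℕ) : axRatio k ≤ 1 := by
  rcases k with _ | k
  · rw [axRatio_zero]; exact criticalTwoPoint_le_one' _
  · have h := criticalTwoPoint_axis_ratio_le_one (1 : Fin 3) k
    exact h

/-- On the axis the second ratio is a ratio of consecutive ratios: `s((n+1)e₂) = r_{n+1}/r_n`. -/
theorem secondRatio_ax_succ (n : ℕ) : secondRatio (ax (n + 1)) = axRatio (n + 1) / axRatio n := by
  have h0 := criticalTwoPoint_pos (ax n)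
  have h1 := criticalTwoPoint_pos (ax (n + 1))
  have h2 := criticalTwoPoint_pos (ax (n + 2))
  rw [secondRatio, ax_add_e₂, ax_succ_sub_e₂, axRatio, axRatio]
  field_simp

/-- **Log-convexity makes the axis second ratio at least one**: `1 ≤ s(n e₂)` for `n ≥ 1`. -/
theorem one_le_secondRatio_ax (n : ℕ) : 1 ≤ secondRatio (ax (n + 1)) := by
  rw [secondRatio_ax_succ, one_le_div (axRatio_pos n)]
  exact axRatio_mono_succ n

/-- On the axis the lower envelope of §7 is one-sided: `G(ne₂)²(s(ne₂) − 1) ≤ ⟨ε₀;ε_{ne₂}⟩`. -/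
theorem sq_mul_secondRatio_sub_one_le_energyTrunc_ax (n : ℕ) :
    criticalTwoPoint 3 (ax (n + 1)) ^ 2 * (secondRatio (ax (n + 1)) - 1) ≤ energyTrunc (ax (n + 1)) := by
  have hG2 : 0 < criticalTwoPoint 3 (ax (n + 1)) ^ 2 := pow_pos (criticalTwoPoint_pos _) 2
  have h := abs_secondRatio_sub_one_le (ax (n + 1))
  rw [abs_of_nonneg (by linarith [one_le_secondRatio_ax n]), le_div_iff₀ hG2] at h
  linarith

/-- **The axis log-convexity defects are summable, with an explicit bound**:
`∑_{n=1}^{N} (s(n e₂) − 1) ≤ r_N/r_0 − 1 ≤ G(e₂)⁻¹ − 1` for every `N`. -/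
theorem sum_secondRatio_ax_sub_one_le_ratio (N : ℕ) :
    ∑ n ∈ Finset.range N, (secondRatio (ax (n + 1)) - 1) ≤ axRatio N / axRatio 0 - 1 := by
  induction N with
  | zero => simp [div_self (axRatio_pos 0).ne']
  | succ N ih =>
    rw [Finset.sum_range_succ, secondRatio_ax_succ]
    have hr0 := axRatio_pos 0
    have hrN := axRatio_pos N
    have hmono : axRatio 0 ≤ axRatio N := axRatio_mono (Nat.zero_le N)
    have hs : 1 ≤ axRatio (N + 1) / axRatio N := by
      rw [one_le_div hrN]; exact axRatio_mono_succ N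
    have hq : 1 ≤ axRatio N / axRatio 0 := by rw [one_le_div hr0]; exact hmono
    -- (s-1)(q-1) ≥ 0 with s = r_{N+1}/r_N, q = r_N/r_0, and s*q = r_{N+1}/r_0
    have hprod : axRatio (N + 1) / axRatio N * (axRatio N / axRatio 0) = axRatio (N + 1) / axRatio 0 := by
      field_simp
    nlinarith [mul_nonneg (sub_nonneg.2 hs) (sub_nonneg.2 hq)]

theorem sum_secondRatio_ax_sub_one_le (N : ℕ) :
    ∑ n ∈ Finset.range N, (secondRatio (ax (n + 1)) - 1) ≤ (criticalTwoPoint 3 e₂)⁻¹ - 1 := by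
  refine (sum_secondRatio_ax_sub_one_le_ratio N).trans ?_
  rw [axRatio_zero, sub_le_sub_iff_right, div_le_iff₀ (criticalTwoPoint_pos _),
    inv_mul_cancel₀ (criticalTwoPoint_pos _).ne']
  exact axRatio_le_one N

/-- **What GAP says on the axis, in two-point terms alone**: a POWER-RATE log-convexity defect
`G((n+1)e₂)G((n−1)e₂) ≤ (1 + C n^{−κ}) G(ne₂)²` — open even on the axis (the tree has only `s → 1`). -/
theorem axis_logConvexityDefect_of_energyGapPowerLaw (h : EnergyGapPowerLaw) :
    ∃ κ C : ℝ, 0 < κ ∧ ∀ n : ℕ, 1 ≤ n →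
      criticalTwoPoint 3 (ax (n + 1)) * criticalTwoPoint 3 (ax (n - 1)) ≤
        (1 + C * (n : ℝ) ^ (-κ)) * criticalTwoPoint 3 (ax n) ^ 2 := by
  obtain ⟨κ, C, hκ, hC⟩ := secondRatioPowerRegular_of_energyGapPowerLaw h
  refine ⟨κ, C, hκ, fun n hn => ?_⟩
  obtain ⟨m, rfl⟩ : ∃ m, n = m + 1 := ⟨n - 1, by omega⟩
  have hx : ax (m + 1) ≠ 0 := by
    intro h0; have := congr_fun h0 1; simp [ax] at this; omega
  have hnorm : ‖ax (m + 1)‖ = ((m + 1 : ℕ) : ℝ) := by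
    rw [ax, Pi.norm_single, Int.norm_eq_abs]; push_cast; exact abs_of_nonneg (by positivity)
  have h1 := hC _ hx
  rw [hnorm] at h1
  have hG2 : 0 < criticalTwoPoint 3 (ax (m + 1)) ^ 2 := pow_pos (criticalTwoPoint_pos _) 2
  have h2 : secondRatio (ax (m + 1)) - 1 ≤ C * ((m + 1 : ℕ) : ℝ) ^ (-κ) := (le_abs_self _).trans h1
  rw [secondRatio, ax_add_e₂, ax_succ_sub_e₂, div_sub_one hG2.ne', div_le_iff₀ hG2] at h2
  rw [show m + 1 - 1 = m by omega, show m + 1 + 1 = m + 2 by omega]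
  linarith


end Summit.CriticalPhenomena.Ising3DConformalLimit.Cruxes.EnergyGapPowerLaw.Disproof
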